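import Summits.QuantumAdvantage.QuantumAdvantage.Theorems.SosSandwichTransferPBWalkDefs
import Literature.Computability.Complexity.OracleComputations
import HarnessLib

/-!
# Route `SosSandwich`, crux `TransferPB` (stmt-QuantumAdvantage-15238): the REFERENCE TRANSCRIPT MACHINE of the machine half (definitions)

`Defs` file (D-0016 convention; no theorem proved here). The implementation statement (M_str) of
`Theorems/SosSandwichTransferPBDescentWalk.lean` asks for ONE transcript machine (`OracleAlg Bool`) whose run with
the combined oracle `A ⊕ g` on `x` is `[20 ≤ meanCount g x (strWalk g x W' 𝟙_A D [])]`, polynomial-time. This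
file WRITES that machine as an oracle computation (`Literature/Computability/Complexity/OracleComputations.lean`:
the free monad `OracleComp`, `toOracleAlg`), mirroring the string-level functions one-to-one:

* `askG v` / `askA u` — query `true :: v` (answer function) / `false :: u` (oracle `A`), decode the bit;
* `filterComp`, `flatMapComp` — `filterM` / `flatMapM` with transparent recursion;
* `liveComp x π j` (↔ `liveLevel`), `candsComp x π W` (↔ `descentCands`), `walkComp x W D π` (↔ `strWalk`,
  pick `List.argmin strNum`, one `A`-query per round), `meansComp x π` (the forty MEAN queries);
* `machineComp Wf Df x` — walk with width bound `Wf x` and budget `Df x`, then the MEAN count, output the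
  threshold bit; **`walkMachine Wf Df : OracleAlg Bool`** — its transcript step function (`toOracleAlg`).

Its correctness for EVERY `g` and `A` (`run_walkMachine`) is `Theorems/SosSandwichTransferPBWalkMachine.lean`; what
(M_str) asks beyond it is `OracleAlg.IsPolyTime` of a machine with these runs (for `Wf`, `Df` polynomial-time
bounds of `oracleWidth` and `machineBudget`, from the uniformity of `F`) and the query-length / round bounds.
Sources: S. Aaronson, A. Ambainis, Theory Comput. 10 (2014), proof of Thm. 23 (p. 14); S. Arora, B. Barak,
Computational Complexity (CUP 2009), §3.4.
-/

-- D-0017: single-conjunct summit ⇒ the duplicate `QuantumAdvantage.QuantumAdvantage` is mandated.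
set_option linter.dupNamespace false

noncomputable section

namespace Summit.QuantumAdvantage.QuantumAdvantage.Cruxes.TransferPB.Birth

open Finset Literature.Computability.Cryptography Literature.Computability.Complexity
  Literature.Computability.QuantumComplexity Literature.Computability.QuantumComplexity.ClassicalSimulation

namespace SimTreePB


section Comps

variable {α β : Type}

/-- Ask the answer function about the instance `v` (query `true :: v`) and decode the answer bit. -/
def askG (v : List Bool) : OracleComp Bool :=
  OracleComp.bind (OracleComp.ask (true :: v)) fun a => OracleComp.pure (Computability.decodeBool a)

/-- Ask the oracle `A` about the string `u` (query `false :: u`) and decode the answer bit. -/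
def askA (u : List Bool) : OracleComp Bool :=
  OracleComp.bind (OracleComp.ask (false :: u)) fun a => OracleComp.pure (Computability.decodeBool a)

/-- Keep the elements of a list whose test computation answers `true` (a `filterM` with transparent recursion). -/
def filterComp (p : α → OracleComp Bool) : List α → OracleComp (List α)
  | [] => OracleComp.pure []
  | a :: l => OracleComp.bind (p a) fun b => OracleComp.bind (filterComp p l) fun l' =>
      OracleComp.pure (if b = true then a :: l' else l')

/-- Concatenate the results of a list-valued computation over a list (a `flatMapM`). -/
def flatMapComp (f : α → OracleComp (List β)) : List α → OracleComp (List β)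
  | [] => OracleComp.pure []
  | a :: l => OracleComp.bind (f a) fun m => OracleComp.bind (flatMapComp f l) fun m' => OracleComp.pure (m ++ m')

end Comps

section Machine

variable (x : List Bool)

/-- The computation of level `j` of the descent at the string path `π` (mirrors `liveLevel`). -/
def liveComp (π : List (List Bool × Bool)) : ℕ → OracleComp (List (List Bool))
  | 0 => OracleComp.bind (askG (encBlockS x π [])) fun b => OracleComp.pure (if b = true then [[]] else [])
  | j + 1 => OracleComp.bind (liveComp π j) fun L =>
      flatMapComp (fun u => filterComp (fun v => askG (encBlockS x π v)) [u ++ [false], u ++ [true]]) L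

/-- The computation of the candidate list at `π` with width bound `W` (mirrors `descentCands`). -/
def candsComp (π : List (List Bool × Bool)) (W : ℕ) : OracleComp (List (List Bool)) :=
  OracleComp.bind (flatMapComp (liveComp x π) (List.range W)) fun all =>
    filterComp (fun u => OracleComp.bind (askG (encSingleS x π u)) fun b =>
      OracleComp.pure (b && decide (u ∉ π.map Prod.fst))) all

/-- The computation of the walk (mirrors `strWalk`): descent, pick of least canonical number, one `A`-query
per round. -/
def walkComp (W : ℕ) : ℕ → List (List Bool × Bool) → OracleComp (List (List Bool × Bool))
  | 0, π => OracleComp.pure π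
  | D + 1, π => OracleComp.bind (candsComp x π W) fun c =>
      match c.argmin strNum with
      | none => OracleComp.pure π
      | some u => OracleComp.bind (askA u) fun b => walkComp W D (π ++ [(u, b)])

/-- The forty MEAN queries at the final path. -/
def meansComp (π : List (List Bool × Bool)) : OracleComp (List Bool) :=
  OracleComp.forEach (fun j => askG (encMeanS x π j)) (Icc 1 40).toList

end Machine

/-- **The reference transcript machine's computation** on input `x`, with width bound `Wf x` and budget `Df x`:
walk, then forty MEAN queries, output `[20 ≤ #true answers]`. -/
def machineComp (Wf Df : List Bool → ℕ) (x : List Bool) : OracleComp Bool :=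
  OracleComp.bind (walkComp x (Wf x) (Df x) []) fun π =>
    OracleComp.bind (meansComp x π) fun bs => OracleComp.pure (decide (20 ≤ (bs.filter fun b => b = true).length))

/-- **The reference transcript machine** (an `OracleAlg Bool`: the transcript step function of `machineComp`). -/
def walkMachine (Wf Df : List Bool → ℕ) : OracleAlg Bool :=
  OracleComp.toOracleAlg (machineComp Wf Df)

end SimTreePB

end Summit.QuantumAdvantage.QuantumAdvantage.Cruxes.TransferPB.Birth

end
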